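import Summits.HodgeConjecture.HodgeConjecture.Theorems.K2E1bU21NormalFormFamily   -- ★ αᵤ-4 first half (K2E4-p10 (g3)): `exists_normalForm_family` (+ ★ αᵤ-1b∕2a∕3)
import Literature.RepresentationTheory.Kovacevic2021.SU21ModulesFromKTypes          -- ★ `SU21Datum` (THE TARGET GAUGE: fields `rel20 … rel45`)
import HarnessLib

/-!
# K2 ∕ E1b · 8b-αᵤ road FILE 4b «THE DATUM OF A `(𝔤, K)`-MODULE OF `U(2,1)`» (second half of row αᵤ-4, O7+O8 of the 8b-α census): Kovačević's
# relations (b20)–(b45) read off the normal-form family, and the ★ `SU21Datum` it assembles (`exists_datum`)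

HCML Track B «K2-LIT», cell `hodgecm-mathlib`, crux H413 = stmt-HodgeConjecture-24833 (supports-only helper; closes nothing by itself).  Socket 8b-αᵤ
`sig_K2E1bModelOfRecordCohUnitary`; DEAL (D-αᵤ4) K2E1b-plan (g4) → K2E4-p10 (g3) 2026-09-04T04:13:05Z; MEMO `K2/K2E1b-plan/g4/MEMO-alpha_u-files-3-5…md` §2.
THEOREMS ONLY (the datum is an `∃`, the structure is built inside the proof; no `def`, no `sorry`, no instance declaration, no notation).

## The statement (`exists_datum`) — what file 5 consumes

Under the hypotheses of ★ `exists_normalForm_family` (`IsGKModule`, a central label `e`, multiplicity one «every ★ `hwSpace ρ𝔤 w` is a line or `0`»):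
`∃ (𝒟 : SU21Datum) (u : ℤ → ℤ → V)` with (i) `u n m ≠ 0 →` `u n m ∈ hwSpace w` for a weight `w` of labels `(n, m, e)`; (ii) `(n, m) ∈ 𝒟.S ↔ u n m ≠ 0`;
(iii) every `y ∈ hwSpace w` (`labelE w = e`) is a multiple of `u (labelN w) (labelM w)`; (iv) the string `f^n (u n m) = 0 ≠ f^k (u n m)` (`k < n`) on `S`;
(v) KOVAČEVIĆ'S THEOREM 1 with the datum's own `𝒟.A 𝒟.B 𝒟.C 𝒟.D`, token-parallel to ★ `Xab_vec Xb_vec Yb_vec Yab_vec` (`vec n m (k+1) ↔ (−f)^k (u n m)`).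

## The proof — Kovačević's Theorem 2 ([Kovacevic2021, §3 Thm. 2 (b20)–(b45)], the necessity direction; the tree's ★ `SU21ModulesFromKTypes` is sufficiency)

With the family `(u, A, B, C, D)` of the first half: evaluate `⁅E₁, F₁⁆ = E₁₁ − E₂₂` (§1, ★ `upqEOp_mul_upqFOp_sub`) on `u¹_{n,m}` ⇒ (b20) along `u¹_{n,m}` and (b30) along
`u²_{n+2,m}`; `⁅E₀, F₀⁆ = E₀₀ − E₂₂` ⇒ (b25); `⁅E₀, E₁⁆ = 0` ⇒ (b40) along `u¹_{n,m+6}`; `⁅F₁, F₀⁆ = 0` ⇒ (b45); `⁅E₁, F₀⁆ = f` ⇒ (b35) along `u¹_{n−2,m}` — the components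
being separated NOT by torus weight (`u²_{n+2,m}`, `u¹_{n,m}`, `u¹_{n−2,m}` share it) but by the raising operator `e` (§2 `sep_of_smul_negf_add_smul`: `e` kills a
primitive vector and sends `(−f)y` to `−(h y)`).  Off the live edges both sides vanish by the first half's conventions.

Sources: [Kovacevic2021] §3 Def. 1, Thm. 1, Thm. 2; [KnappVogan1995] §IV.1; [BorelWallach2000] II §4.1.
HONEST LABEL: a helper of the 8b-αᵤ road (file 4b of 5); it closes nothing by itself; HC_CM is proved only modulo the 7 printed citations (2 remaining named
inputs: hLiu418 = stmt-HodgeConjecture-24832, h413 = stmt-HodgeConjecture-24833) until rung 0 closes.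
-/

-- Mathlib idiom (as in ★ `U21RootMonomials`, ★ αᵤ-1∕1b∕2a∕3∕4a, ★ `SU21ModulesFromKTypes`): commutator bracket on `Module.End ℂ V` and on matrices.
attribute [local instance 100] LieRing.ofAssociativeRing

set_option autoImplicit false
set_option linter.dupNamespace false

noncomputable section

namespace Summit.HodgeConjecture.HodgeConjecture.Cruxes.H413.K2E1bU21DatumRelations

open Literature.RepresentationTheory Literature.RepresentationTheory.KonnoKonno2007
open Literature.RepresentationTheory.Kovacevic2021
open Literature.NumberTheory.Automorphic
open Summit.HodgeConjecture.HodgeConjecture.Cruxes.H413.F0P3bLocalAPacketsDefs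
open Summit.HodgeConjecture.HodgeConjecture.Cruxes.H413.K2E1bU21Weights
open Summit.HodgeConjecture.HodgeConjecture.Cruxes.H413.K2E1bU21PActionNormalForm
open Summit.HodgeConjecture.HodgeConjecture.Cruxes.H413.K2E1bU21NormalFormFamily

variable {V : Type*} [AddCommGroup V] [Module ℂ V]
  {ρK : Representation ℂ G21.maximalCompact V} (ρ𝔤 : G21.lie →ₗ⁅ℝ⁆ Module.End ℂ V)

/-! ## §1 The four brackets between `𝔭⁺` and `𝔭⁻` (★ `upqEOp_mul_upqFOp_sub`) -/

/-- `⁅E₁, F₁⁆ = E₁₁ − E₂₂` (`= H_β`), applied to a vector. [cite: Kovacevic2021, §3 (Thm. 2, proof)] [cite: BorelWallach2000, II §4.1] -/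
theorem u21E_one_u21F_one_sub (x : V) :
    u21E ρ𝔤 1 (u21F ρ𝔤 1 x) - u21F ρ𝔤 1 (u21E ρ𝔤 1 x) =
      upqLieC ρ𝔤 (Matrix.single (Sum.inl 1) (Sum.inl 1) (1 : ℂ)) x - upqLieC ρ𝔤 (Matrix.single (Sum.inr 0) (Sum.inr 0) (1 : ℂ)) x := by
  have h := upqEOp_mul_upqFOp_sub ρ𝔤 (Matrix.single (1 : Fin 2) (0 : Fin 1) (1 : ℂ)) (Matrix.single (0 : Fin 1) (1 : Fin 2) (1 : ℂ))
  have hm : (Matrix.fromBlocks (Matrix.single (1 : Fin 2) (0 : Fin 1) (1 : ℂ) * Matrix.single (0 : Fin 1) (1 : Fin 2) (1 : ℂ)) 0 0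
      (-(Matrix.single (0 : Fin 1) (1 : Fin 2) (1 : ℂ) * Matrix.single (1 : Fin 2) (0 : Fin 1) (1 : ℂ))) : Matrix (Fin 2 ⊕ Fin 1) (Fin 2 ⊕ Fin 1) ℂ) =
      Matrix.single (Sum.inl 1) (Sum.inl 1) 1 - Matrix.single (Sum.inr 0) (Sum.inr 0) 1 := by
    ext (i | i) (k | k) <;> fin_cases i <;> fin_cases k <;> simp [Matrix.fromBlocks]
  rw [hm, map_sub, ← u21E_def, ← u21F_def] at h
  simpa only [LinearMap.sub_apply, Module.End.mul_apply] using LinearMap.congr_fun h x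

/-- `⁅E₀, F₀⁆ = E₀₀ − E₂₂` (`= H_α + H_β`), applied to a vector. [cite: Kovacevic2021, §3 (Thm. 2, proof)] [cite: BorelWallach2000, II §4.1] -/
theorem u21E_zero_u21F_zero_sub (x : V) :
    u21E ρ𝔤 0 (u21F ρ𝔤 0 x) - u21F ρ𝔤 0 (u21E ρ𝔤 0 x) =
      upqLieC ρ𝔤 (Matrix.single (Sum.inl 0) (Sum.inl 0) (1 : ℂ)) x - upqLieC ρ𝔤 (Matrix.single (Sum.inr 0) (Sum.inr 0) (1 : ℂ)) x := by
  have h := upqEOp_mul_upqFOp_sub ρ𝔤 (Matrix.single (0 : Fin 2) (0 : Fin 1) (1 : ℂ)) (Matrix.single (0 : Fin 1) (0 : Fin 2) (1 : ℂ))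
  have hm : (Matrix.fromBlocks (Matrix.single (0 : Fin 2) (0 : Fin 1) (1 : ℂ) * Matrix.single (0 : Fin 1) (0 : Fin 2) (1 : ℂ)) 0 0
      (-(Matrix.single (0 : Fin 1) (0 : Fin 2) (1 : ℂ) * Matrix.single (0 : Fin 2) (0 : Fin 1) (1 : ℂ))) : Matrix (Fin 2 ⊕ Fin 1) (Fin 2 ⊕ Fin 1) ℂ) =
      Matrix.single (Sum.inl 0) (Sum.inl 0) 1 - Matrix.single (Sum.inr 0) (Sum.inr 0) 1 := by
    ext (i | i) (k | k) <;> fin_cases i <;> fin_cases k <;> simp [Matrix.fromBlocks]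
  rw [hm, map_sub, ← u21E_def, ← u21F_def] at h
  simpa only [LinearMap.sub_apply, Module.End.mul_apply] using LinearMap.congr_fun h x

/-- `⁅E₁, F₀⁆ = E₁₀ = f`, applied to a vector. [cite: Kovacevic2021, §3 (Thm. 2, proof)] [cite: BorelWallach2000, II §4.1] -/
theorem u21E_one_u21F_zero_sub (x : V) :
    u21E ρ𝔤 1 (u21F ρ𝔤 0 x) - u21F ρ𝔤 0 (u21E ρ𝔤 1 x) = u21f ρ𝔤 x := by
  have h := upqEOp_mul_upqFOp_sub ρ𝔤 (Matrix.single (1 : Fin 2) (0 : Fin 1) (1 : ℂ)) (Matrix.single (0 : Fin 1) (0 : Fin 2) (1 : ℂ))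
  have hm : (Matrix.fromBlocks (Matrix.single (1 : Fin 2) (0 : Fin 1) (1 : ℂ) * Matrix.single (0 : Fin 1) (0 : Fin 2) (1 : ℂ)) 0 0
      (-(Matrix.single (0 : Fin 1) (0 : Fin 2) (1 : ℂ) * Matrix.single (1 : Fin 2) (0 : Fin 1) (1 : ℂ))) : Matrix (Fin 2 ⊕ Fin 1) (Fin 2 ⊕ Fin 1) ℂ) =
      Matrix.fromBlocks (Matrix.single 1 0 (1 : ℂ)) 0 0 (0 : Matrix (Fin 1) (Fin 1) ℂ) := by
    ext (i | i) (k | k) <;> fin_cases i <;> fin_cases k <;> simp [Matrix.fromBlocks]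
  rw [hm, ← u21E_def, ← u21F_def] at h
  have hf : upqLieC ρ𝔤 (Matrix.fromBlocks (Matrix.single 1 0 (1 : ℂ)) 0 0 (0 : Matrix (Fin 1) (Fin 1) ℂ)) = u21f ρ𝔤 := rfl
  rw [hf] at h
  simpa only [LinearMap.sub_apply, Module.End.mul_apply] using LinearMap.congr_fun h x

/-! ## §2 Separation of components by the raising operator `e` -/

/-- **Separation lemma**: if `α • (−f) y + β • x = 0` with `x, y` primitive (`e x = e y = 0`) and `h y = μ y`, `μ ≠ 0`, then `α = 0` unless `y = 0`, and
`β = 0` unless `x = 0` — apply `e`, which kills `x` and sends `(−f) y` to `−h y = −μ y` (`e f = f e + h`). [cite: Kovacevic2021, §3 Thm. 2 (proof)]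
[cite: KnappVogan1995, §IV.1] -/
theorem sep_of_smul_negf_add_smul {x y : V} (hex : u21e ρ𝔤 x = 0) (hey : u21e ρ𝔤 y = 0) {μ : ℂ} (hhy : u21h ρ𝔤 y = μ • y) (hμ : μ ≠ 0)
    {α β : ℂ} (H : α • (-u21f ρ𝔤) y + β • x = 0) : (y ≠ 0 → α = 0) ∧ (x ≠ 0 → β = 0) := by
  have hef : u21e ρ𝔤 (u21f ρ𝔤 y) = u21f ρ𝔤 (u21e ρ𝔤 y) + u21h ρ𝔤 y := by
    have := LinearMap.congr_fun (u21e_mul_u21f_sub ρ𝔤) y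
    simp only [Module.End.mul_apply, LinearMap.sub_apply] at this
    rw [← this]; abel
  have h1 := congrArg (u21e ρ𝔤) H
  rw [map_add, map_smul, map_smul, LinearMap.neg_apply, map_neg, hef, hey, map_zero, zero_add, hhy, hex, smul_zero, add_zero,
    map_zero, smul_neg, smul_smul, neg_eq_zero, smul_eq_zero, mul_eq_zero] at h1
  have hα : y ≠ 0 → α = 0 := fun hy => by
    rcases h1 with (h | h) | h
    · exact h
    · exact absurd h hμ
    · exact absurd h hy
  refine ⟨hα, fun hx => ?_⟩
  by_cases hy : y = 0
  · rw [hy, map_zero, smul_zero, zero_add, smul_eq_zero] at H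
    exact H.resolve_right hx
  · rw [hα hy, zero_smul, zero_add, smul_eq_zero] at H
    exact H.resolve_right hx

/-! ## §3 The relations (b20)–(b45) from the normal form

Throughout, `u` is a family of primitive vectors with `h (u n m) = (n − 1) u n m`, and `A B C D` satisfy Kovačević's normal form at `k = 0, 1`
(the clauses (v) of ★ `exists_normalForm_family`, spelled out). -/

section Relations

variable {u : ℤ → ℤ → V} {A B C D : ℤ → ℤ → ℂ}
  (hprim : ∀ n m, u21e ρ𝔤 (u n m) = 0)
  (hh : ∀ n m, u21h ρ𝔤 (u n m) = ((n : ℂ) - 1) • u n m)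
  (T1₀ : ∀ n m, u21E ρ𝔤 0 (u n m) = ((n : ℂ) * A n m) • u (n + 1) (m + 3))
  (T1₁ : ∀ n m, u21E ρ𝔤 0 ((-u21f ρ𝔤) (u n m)) =
    (((n : ℂ) - 1) * A n m) • (-u21f ρ𝔤) (u (n + 1) (m + 3)) + C n m • u (n - 1) (m + 3))
  (T2₀ : ∀ n m, u21E ρ𝔤 1 (u n m) = (-A n m) • (-u21f ρ𝔤) (u (n + 1) (m + 3)) + C n m • u (n - 1) (m + 3))
  (T2₁ : ∀ n m, u21E ρ𝔤 1 ((-u21f ρ𝔤) (u n m)) =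
    (-A n m) • (-u21f ρ𝔤) ((-u21f ρ𝔤) (u (n + 1) (m + 3))) + C n m • (-u21f ρ𝔤) (u (n - 1) (m + 3)))
  (T3₀ : ∀ n m, u21F ρ𝔤 1 (u n m) = ((n : ℂ) * B n m) • u (n + 1) (m - 3))
  (T3₁ : ∀ n m, u21F ρ𝔤 1 ((-u21f ρ𝔤) (u n m)) =
    (((n : ℂ) - 1) * B n m) • (-u21f ρ𝔤) (u (n + 1) (m - 3)) - D n m • u (n - 1) (m - 3))
  (T4₀ : ∀ n m, u21F ρ𝔤 0 (u n m) = B n m • (-u21f ρ𝔤) (u (n + 1) (m - 3)) + D n m • u (n - 1) (m - 3))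
  (T4₁ : ∀ n m, u21F ρ𝔤 0 ((-u21f ρ𝔤) (u n m)) =
    B n m • (-u21f ρ𝔤) ((-u21f ρ𝔤) (u (n + 1) (m - 3))) + D n m • (-u21f ρ𝔤) (u (n - 1) (m - 3)))

include hprim hh T2₀ T3₀ T3₁ in
/-- **(b20) and (b30) from `⁅E₁, F₁⁆ = H_β` on `u¹_{n,m}`**: the coefficient of `u¹_{n,m}` is (b20) (`rel20` of ★ `SU21Datum`), that of `u²_{n+2,m}` is (b30)
(`rel30`); `H_β u¹_{n,m} = ((m−n+1)∕2) u¹_{n,m}` enters as the hypothesis `hHβ`. [cite: Kovacevic2021, §3 Thm. 2 (b20), (b30)] -/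
theorem rel20_rel30_of_normalForm (n m : ℤ) (hn : (n : ℂ) + 1 ≠ 0)
    (hHβ : upqLieC ρ𝔤 (Matrix.single (Sum.inl 1) (Sum.inl 1) (1 : ℂ)) (u n m) - upqLieC ρ𝔤 (Matrix.single (Sum.inr 0) (Sum.inr 0) (1 : ℂ)) (u n m) =
      (((m : ℂ) - n + 1) / 2) • u n m) :
    (u n m ≠ 0 → -(A n m * D (n + 1) (m + 3)) + (n : ℂ) * (B n m * C (n + 1) (m - 3)) - ((n : ℂ) - 1) * (C n m * B (n - 1) (m + 3)) =
        ((m : ℂ) - n + 1) / 2) ∧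
      (u (n + 1 + 1) m ≠ 0 → (n : ℂ) * (B n m * A (n + 1) (m - 3)) = (n : ℂ) * (A n m * B (n + 1) (m + 3))) := by
  have H := u21E_one_u21F_one_sub ρ𝔤 (u n m)
  rw [hHβ, T3₀, map_smul, T2₀ (n + 1) (m - 3), T2₀ n m, map_add, map_smul, map_smul, T3₁ (n + 1) (m + 3), T3₀ (n - 1) (m + 3)] at H
  simp only [add_sub_cancel_right, sub_add_cancel] at H
  push_cast at H
  have H' : ((n : ℂ) * (A n m * B (n + 1) (m + 3) - B n m * A (n + 1) (m - 3))) • (-u21f ρ𝔤) (u (n + 1 + 1) m) +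
      ((n : ℂ) * (B n m * C (n + 1) (m - 3)) - A n m * D (n + 1) (m + 3) - ((n : ℂ) - 1) * (C n m * B (n - 1) (m + 3))
        - ((m : ℂ) - n + 1) / 2) • u n m = 0 := by
    rw [← sub_eq_zero] at H
    rw [← H]
    module
  obtain ⟨hα, hβ⟩ := sep_of_smul_negf_add_smul ρ𝔤 (hprim n m) (hprim _ _) (hh _ _) (by push_cast; ring_nf; ring_nf at hn; exact hn) H'
  refine ⟨fun hx => ?_, fun hy => ?_⟩
  · linear_combination hβ hx
  · linear_combination -(hα hy)

include hprim hh T1₀ T1₁ T4₀ in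
/-- **(b25) from `⁅E₀, F₀⁆ = H_α + H_β` on `u¹_{n,m}`** (coefficient of `u¹_{n,m}`; `(H_α+H_β) u¹_{n,m} = ((m+n−1)∕2) u¹_{n,m}` enters as `hHαβ`).
[cite: Kovacevic2021, §3 Thm. 2 (b25)] -/
theorem rel25_of_normalForm (n m : ℤ) (hn : (n : ℂ) + 1 ≠ 0)
    (hHαβ : upqLieC ρ𝔤 (Matrix.single (Sum.inl 0) (Sum.inl 0) (1 : ℂ)) (u n m) - upqLieC ρ𝔤 (Matrix.single (Sum.inr 0) (Sum.inr 0) (1 : ℂ)) (u n m) =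
      (((m : ℂ) + n - 1) / 2) • u n m) (hx : u n m ≠ 0) :
    -((n : ℂ) * (A n m * D (n + 1) (m + 3))) + B n m * C (n + 1) (m - 3) + ((n : ℂ) - 1) * (D n m * A (n - 1) (m - 3)) =
      ((m : ℂ) + n - 1) / 2 := by
  have H := u21E_zero_u21F_zero_sub ρ𝔤 (u n m)
  rw [hHαβ, T4₀ n m, map_add, map_smul, map_smul, T1₁ (n + 1) (m - 3), T1₀ (n - 1) (m - 3), T1₀ n m, map_smul,
    T4₀ (n + 1) (m + 3)] at H
  simp only [add_sub_cancel_right, sub_add_cancel] at H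
  push_cast at H
  have H' : ((n : ℂ) * (B n m * A (n + 1) (m - 3) - A n m * B (n + 1) (m + 3))) • (-u21f ρ𝔤) (u (n + 1 + 1) m) +
      (B n m * C (n + 1) (m - 3) + ((n : ℂ) - 1) * (D n m * A (n - 1) (m - 3)) - (n : ℂ) * (A n m * D (n + 1) (m + 3))
        - ((m : ℂ) + n - 1) / 2) • u n m = 0 := by
    rw [← sub_eq_zero] at H
    rw [← H]
    module
  obtain ⟨-, hβ⟩ := sep_of_smul_negf_add_smul ρ𝔤 (hprim n m) (hprim _ _) (hh _ _) (by push_cast; ring_nf; ring_nf at hn; exact hn) H'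
  linear_combination hβ hx

include T1₀ T1₁ T2₀ in
/-- **(b40) from `⁅E₀, E₁⁆ = 0` on `u¹_{n,m}`** (coefficient of `u¹_{n,m+6}`; the `u²_{n+2,m+6}` components cancel identically).
[cite: Kovacevic2021, §3 Thm. 2 (b40)] -/
theorem rel40_of_normalForm (n m : ℤ) (hz : u n (m + 3 + 3) ≠ 0) :
    ((n : ℂ) + 1) * (A n m * C (n + 1) (m + 3)) = ((n : ℂ) - 1) * (C n m * A (n - 1) (m + 3)) := by
  have H : u21E ρ𝔤 0 (u21E ρ𝔤 1 (u n m)) = u21E ρ𝔤 1 (u21E ρ𝔤 0 (u n m)) := by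
    simpa only [Module.End.mul_apply] using LinearMap.congr_fun (u21E_comm ρ𝔤 0 1) (u n m)
  rw [T2₀ n m, map_add, map_smul, map_smul, T1₁ (n + 1) (m + 3), T1₀ (n - 1) (m + 3), T1₀ n m, map_smul, T2₀ (n + 1) (m + 3)] at H
  simp only [add_sub_cancel_right, sub_add_cancel] at H
  push_cast at H
  have H' : (((n : ℂ) - 1) * (C n m * A (n - 1) (m + 3)) - ((n : ℂ) + 1) * (A n m * C (n + 1) (m + 3))) • u n (m + 3 + 3) = 0 := by
    rw [← sub_eq_zero] at H
    rw [← H]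
    module
  have := (smul_eq_zero.1 H').resolve_right hz
  linear_combination -this

include T3₀ T3₁ T4₀ in
/-- **(b45) from `⁅F₀, F₁⁆ = 0` on `u¹_{n,m}`** (coefficient of `u¹_{n,m−6}`). [cite: Kovacevic2021, §3 Thm. 2 (b45)] -/
theorem rel45_of_normalForm (n m : ℤ) (hz : u n (m - 3 - 3) ≠ 0) :
    ((n : ℂ) + 1) * (B n m * D (n + 1) (m - 3)) = ((n : ℂ) - 1) * (D n m * B (n - 1) (m - 3)) := by
  have H : u21F ρ𝔤 1 (u21F ρ𝔤 0 (u n m)) = u21F ρ𝔤 0 (u21F ρ𝔤 1 (u n m)) := by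
    simpa only [Module.End.mul_apply] using LinearMap.congr_fun (u21F_comm ρ𝔤 1 0) (u n m)
  rw [T4₀ n m, map_add, map_smul, map_smul, T3₁ (n + 1) (m - 3), T3₀ (n - 1) (m - 3), T3₀ n m, map_smul, T4₀ (n + 1) (m - 3)] at H
  simp only [add_sub_cancel_right, sub_add_cancel] at H
  push_cast at H
  have H' : (((n : ℂ) - 1) * (D n m * B (n - 1) (m - 3)) - ((n : ℂ) + 1) * (B n m * D (n + 1) (m - 3))) • u n (m - 3 - 3) = 0 := by
    rw [← sub_eq_zero] at H
    rw [← H]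
    module
  have := (smul_eq_zero.1 H').resolve_right hz
  linear_combination -this

include hprim hh T2₀ T2₁ T4₀ T4₁ in
/-- **(b35) from `⁅E₁, F₀⁆ = Y_α` on `u¹_{n,m}`** (coefficient of `u¹_{n−2,m}`, after the `u³_{n+2,m}` component is removed by (b30) and the `u²_{n,m}` component by
`e`, which sends `u²_{n,m}` to `−(n−1) u¹_{n,m}` — whence `n ≠ 1`). [cite: Kovacevic2021, §3 Thm. 2 (b35)] -/
theorem rel35_of_normalForm (n m : ℤ) (hn : (n : ℂ) - 1 ≠ 0) (h30 : B n m * A (n + 1) (m - 3) = A n m * B (n + 1) (m + 3))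
    (hz : u (n - 1 - 1) m ≠ 0) :
    D n m * C (n - 1) (m - 3) = C n m * D (n - 1) (m + 3) := by
  have H := u21E_one_u21F_zero_sub ρ𝔤 (u n m)
  have hf : u21f ρ𝔤 (u n m) = -((-u21f ρ𝔤) (u n m)) := by rw [LinearMap.neg_apply, neg_neg]
  rw [hf, T4₀ n m, map_add, map_smul, map_smul, T2₁ (n + 1) (m - 3), T2₀ (n - 1) (m - 3), T2₀ n m, map_add, map_smul, map_smul,
    T4₁ (n + 1) (m + 3), T4₀ (n - 1) (m + 3)] at H
  simp only [add_sub_cancel_right, sub_add_cancel] at H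
  have hα : A n m * B (n + 1) (m + 3) - B n m * A (n + 1) (m - 3) = 0 := sub_eq_zero.2 h30.symm
  have H' : (B n m * C (n + 1) (m - 3) - D n m * A (n - 1) (m - 3) + A n m * D (n + 1) (m + 3) - C n m * B (n - 1) (m + 3) + 1) •
        (-u21f ρ𝔤) (u n m) +
      (D n m * C (n - 1) (m - 3) - C n m * D (n - 1) (m + 3)) • u (n - 1 - 1) m = 0 := by
    rw [← sub_eq_zero] at H
    calc _ = (B n m * C (n + 1) (m - 3) - D n m * A (n - 1) (m - 3) + A n m * D (n + 1) (m + 3) - C n m * B (n - 1) (m + 3) + 1) •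
            (-u21f ρ𝔤) (u n m) + (D n m * C (n - 1) (m - 3) - C n m * D (n - 1) (m + 3)) • u (n - 1 - 1) m
            + (A n m * B (n + 1) (m + 3) - B n m * A (n + 1) (m - 3)) • (-u21f ρ𝔤) ((-u21f ρ𝔤) (u (n + 1 + 1) m)) := by
          rw [hα, zero_smul, add_zero]
      _ = _ := by rw [← H]; module
  obtain ⟨-, hγ⟩ := sep_of_smul_negf_add_smul ρ𝔤 (hprim _ _) (hprim n m) (hh n m) hn H'
  linear_combination hγ hz

end Relations

/-! ## §4 The datum -/

/-- **THE KOVAČEVIĆ DATUM OF A `(𝔤, K)`-MODULE OF `U(2,1)`** (Kovačević's Theorem 2, necessity direction, at central label `e`, under multiplicity one):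
the normal-form family of ★ `exists_normalForm_family` satisfies (b20)–(b45) (§3), so `S := {(n,m) | u n m ≠ 0}` and its coefficients ARE an ★ `SU21Datum`;
exported together with the witness family `u` (labels and membership, every `K`-type hit, the strings, and Theorem 1 with the datum's own `A B C D`), so that
file 5 builds the basis `u n m k ↔ 𝒟.vec n m k` and the `GKEquiv` without reopening files 3–4. [cite: Kovacevic2021, §3 Def. 1, Thm. 1, Thm. 2]
[cite: KnappVogan1995, §IV.1] [cite: BorelWallach2000, II §4.1] -/
theorem exists_datum (hGK : IsGKModule G21 ρK ρ𝔤) (e : ℤ)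
    (hmult : ∀ w : Fin 2 ⊕ Fin 1 → ℤ, ∃ g : V, g ∈ hwSpace ρ𝔤 w ∧ ∀ y ∈ hwSpace ρ𝔤 w, ∃ c : ℂ, y = c • g) :
    ∃ (𝒟 : SU21Datum) (u : ℤ → ℤ → V),
      (∀ n m : ℤ, u n m ≠ 0 → ∃ w, labelN w = n ∧ labelM w = m ∧ labelE w = e ∧ u n m ∈ hwSpace ρ𝔤 w) ∧
      (∀ n m : ℤ, (n, m) ∈ 𝒟.S ↔ u n m ≠ 0) ∧
      (∀ (w : Fin 2 ⊕ Fin 1 → ℤ) (y : V), labelE w = e → y ∈ hwSpace ρ𝔤 w → ∃ c : ℂ, y = c • u (labelN w) (labelM w)) ∧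
      (∀ n m : ℤ, u n m ≠ 0 → (u21f ρ𝔤 ^ n.toNat) (u n m) = 0 ∧ ∀ k < n.toNat, (u21f ρ𝔤 ^ k) (u n m) ≠ 0) ∧
      (∀ (n m : ℤ) (k : ℕ),
        u21E ρ𝔤 0 (((-u21f ρ𝔤) ^ k) (u n m)) =
            (((n : ℂ) - k) * 𝒟.A n m) • ((-u21f ρ𝔤) ^ k) (u (n + 1) (m + 3)) + ((k : ℂ) * 𝒟.C n m) • ((-u21f ρ𝔤) ^ (k - 1)) (u (n - 1) (m + 3)) ∧
        u21E ρ𝔤 1 (((-u21f ρ𝔤) ^ k) (u n m)) =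
            (-𝒟.A n m) • ((-u21f ρ𝔤) ^ (k + 1)) (u (n + 1) (m + 3)) + 𝒟.C n m • ((-u21f ρ𝔤) ^ k) (u (n - 1) (m + 3)) ∧
        u21F ρ𝔤 1 (((-u21f ρ𝔤) ^ k) (u n m)) =
            (((n : ℂ) - k) * 𝒟.B n m) • ((-u21f ρ𝔤) ^ k) (u (n + 1) (m - 3)) - ((k : ℂ) * 𝒟.D n m) • ((-u21f ρ𝔤) ^ (k - 1)) (u (n - 1) (m - 3)) ∧
        u21F ρ𝔤 0 (((-u21f ρ𝔤) ^ k) (u n m)) =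
            𝒟.B n m • ((-u21f ρ𝔤) ^ (k + 1)) (u (n + 1) (m - 3)) + 𝒟.D n m • ((-u21f ρ𝔤) ^ k) (u (n - 1) (m - 3))) := by
  obtain ⟨u, A, B, C, D, hi, hii, hiii, hzero, hT⟩ := exists_normalForm_family ρ𝔤 hGK e hmult
  -- primitivity, `h`-weights, and the two Cartan scalars of the family
  have hprim : ∀ n m, u21e ρ𝔤 (u n m) = 0 := by
    intro n m
    by_cases h0 : u n m = 0
    · rw [h0, map_zero]
    · obtain ⟨w, -, -, -, hw⟩ := hi n m h0
      exact ((mem_hwSpace_iff ρ𝔤 w _).1 hw).2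
  have hh : ∀ n m, u21h ρ𝔤 (u n m) = ((n : ℂ) - 1) • u n m := by
    intro n m
    by_cases h0 : u n m = 0
    · rw [h0, map_zero, smul_zero]
    · obtain ⟨w, h1, -, -, hw⟩ := hi n m h0
      rw [u21h_apply_of_mem_wtSpace' ρ𝔤 ((mem_hwSpace_iff ρ𝔤 w _).1 hw).1, h1, Int.cast_sub, Int.cast_one]
  have hHβ : ∀ n m, upqLieC ρ𝔤 (Matrix.single (Sum.inl 1) (Sum.inl 1) (1 : ℂ)) (u n m) -
      upqLieC ρ𝔤 (Matrix.single (Sum.inr 0) (Sum.inr 0) (1 : ℂ)) (u n m) = (((m : ℂ) - n + 1) / 2) • u n m := by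
    intro n m
    by_cases h0 : u n m = 0
    · rw [h0, map_zero, map_zero, smul_zero, sub_zero]
    · obtain ⟨w, h1, h2, -, hw⟩ := hi n m h0
      have hv := (mem_wtSpace_iff ρ𝔤 w _).1 ((mem_hwSpace_iff ρ𝔤 w _).1 hw).1
      rw [hv, hv, ← sub_smul, ← h1, ← h2, labelN, labelM]
      congr 1
      push_cast
      ring
  have hHαβ : ∀ n m, upqLieC ρ𝔤 (Matrix.single (Sum.inl 0) (Sum.inl 0) (1 : ℂ)) (u n m) -
      upqLieC ρ𝔤 (Matrix.single (Sum.inr 0) (Sum.inr 0) (1 : ℂ)) (u n m) = (((m : ℂ) + n - 1) / 2) • u n m := by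
    intro n m
    by_cases h0 : u n m = 0
    · rw [h0, map_zero, map_zero, smul_zero, sub_zero]
    · obtain ⟨w, h1, h2, -, hw⟩ := hi n m h0
      have hv := (mem_wtSpace_iff ρ𝔤 w _).1 ((mem_hwSpace_iff ρ𝔤 w _).1 hw).1
      rw [hv, hv, ← sub_smul, ← h1, ← h2, labelN, labelM]
      congr 1
      push_cast
      ring
  -- Theorem 1 at `k = 0, 1`
  have T1₀ : ∀ n m, u21E ρ𝔤 0 (u n m) = ((n : ℂ) * A n m) • u (n + 1) (m + 3) := fun n m => by
    simpa only [pow_zero, Module.End.one_apply, Nat.cast_zero, sub_zero, zero_mul, zero_smul, add_zero] using (hT n m 0).1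
  have T1₁ : ∀ n m, u21E ρ𝔤 0 ((-u21f ρ𝔤) (u n m)) =
      (((n : ℂ) - 1) * A n m) • (-u21f ρ𝔤) (u (n + 1) (m + 3)) + C n m • u (n - 1) (m + 3) := fun n m => by
    simpa only [pow_one, pow_zero, Module.End.one_apply, Nat.cast_one, one_mul, Nat.sub_self] using (hT n m 1).1
  have T2₀ : ∀ n m, u21E ρ𝔤 1 (u n m) = (-A n m) • (-u21f ρ𝔤) (u (n + 1) (m + 3)) + C n m • u (n - 1) (m + 3) := fun n m => by
    simpa only [pow_zero, Module.End.one_apply, zero_add, pow_one] using (hT n m 0).2.1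
  have T2₁ : ∀ n m, u21E ρ𝔤 1 ((-u21f ρ𝔤) (u n m)) =
      (-A n m) • (-u21f ρ𝔤) ((-u21f ρ𝔤) (u (n + 1) (m + 3))) + C n m • (-u21f ρ𝔤) (u (n - 1) (m + 3)) := fun n m => by
    simpa only [pow_succ, pow_zero, one_mul, Module.End.mul_apply] using (hT n m 1).2.1
  have T3₀ : ∀ n m, u21F ρ𝔤 1 (u n m) = ((n : ℂ) * B n m) • u (n + 1) (m - 3) := fun n m => by
    simpa only [pow_zero, Module.End.one_apply, Nat.cast_zero, sub_zero, zero_mul, zero_smul, sub_zero] using (hT n m 0).2.2.1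
  have T3₁ : ∀ n m, u21F ρ𝔤 1 ((-u21f ρ𝔤) (u n m)) =
      (((n : ℂ) - 1) * B n m) • (-u21f ρ𝔤) (u (n + 1) (m - 3)) - D n m • u (n - 1) (m - 3) := fun n m => by
    simpa only [pow_one, pow_zero, Module.End.one_apply, Nat.cast_one, one_mul, Nat.sub_self] using (hT n m 1).2.2.1
  have T4₀ : ∀ n m, u21F ρ𝔤 0 (u n m) = B n m • (-u21f ρ𝔤) (u (n + 1) (m - 3)) + D n m • u (n - 1) (m - 3) := fun n m => by
    simpa only [pow_zero, Module.End.one_apply, zero_add, pow_one] using (hT n m 0).2.2.2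
  have T4₁ : ∀ n m, u21F ρ𝔤 0 ((-u21f ρ𝔤) (u n m)) =
      B n m • (-u21f ρ𝔤) ((-u21f ρ𝔤) (u (n + 1) (m - 3))) + D n m • (-u21f ρ𝔤) (u (n - 1) (m - 3)) := fun n m => by
    simpa only [pow_succ, pow_zero, one_mul, Module.End.mul_apply] using (hT n m 1).2.2.2
  -- `n + 1 ≠ 0` on `S`
  have hn1 : ∀ n m, u n m ≠ 0 → (n : ℂ) + 1 ≠ 0 := fun n m h0 => by
    have := (hiii n m h0).1
    exact_mod_cast (show n + 1 ≠ 0 by omega)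
  -- (b30) everywhere
  have h30 : ∀ n m, B n m * A (n + 1) (m - 3) = A n m * B (n + 1) (m + 3) := by
    intro n m
    by_cases h0 : u n m = 0
    · obtain ⟨hA, hB, -, -⟩ := (hzero n m).1 h0
      rw [hA, hB, zero_mul, zero_mul]
    by_cases hy : u (n + 1 + 1) m = 0
    · have hA' : A (n + 1) (m - 3) = 0 := by
        have := (hzero (n + 1) (m - 3)).2.1; rw [sub_add_cancel] at this; exact this hy
      have hB' : B (n + 1) (m + 3) = 0 := by
        have := (hzero (n + 1) (m + 3)).2.2.2.1; rw [add_sub_cancel_right] at this; exact this hy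
      rw [hA', hB', mul_zero, mul_zero]
    · have hn0 : (n : ℂ) ≠ 0 := by
        have := (hiii n m h0).1
        exact_mod_cast (show n ≠ 0 by omega)
      exact mul_left_cancel₀ hn0 ((rel20_rel30_of_normalForm ρ𝔤 hprim hh T2₀ T3₀ T3₁ n m (hn1 n m h0) (hHβ n m)).2 hy)
  refine ⟨⟨{p | u p.1 p.2 ≠ 0}, A, B, C, D, fun h => (hiii _ _ h).1, fun h => ((hzero _ _).1 (not_not.1 h)).1,
    fun h => ((hzero _ _).1 (not_not.1 h)).2.1, fun h => ((hzero _ _).1 (not_not.1 h)).2.2.1, fun h => ((hzero _ _).1 (not_not.1 h)).2.2.2,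
    fun {n m} h => (rel20_rel30_of_normalForm ρ𝔤 hprim hh T2₀ T3₀ T3₁ n m (hn1 n m h) (hHβ n m)).1 h,
    fun {n m} h => rel25_of_normalForm ρ𝔤 hprim hh T1₀ T1₁ T4₀ n m (hn1 n m h) (hHαβ n m) h, h30, fun n m => ?_, fun n m => ?_, fun n m => ?_⟩,
    u, hi, fun n m => Iff.rfl, hii, fun n m h => (hiii n m h).2, hT⟩
  · -- (b35)
    by_cases h0 : u n m = 0
    · obtain ⟨-, -, hC, hD⟩ := (hzero n m).1 h0
      rw [hC, hD, zero_mul, zero_mul]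
    by_cases hz : u (n - 1 - 1) m = 0
    · have hC' : C (n - 1) (m - 3) = 0 := by
        have := (hzero (n - 1) (m - 3)).2.2.1; rw [sub_add_cancel] at this; exact this hz
      have hD' : D (n - 1) (m + 3) = 0 := by
        have := (hzero (n - 1) (m + 3)).2.2.2.2; rw [add_sub_cancel_right] at this; exact this hz
      rw [hC', hD', mul_zero, mul_zero]
    · have hn : (n : ℂ) - 1 ≠ 0 := by
        have := (hiii _ _ hz).1
        exact_mod_cast (show n - 1 ≠ 0 by omega)
      exact rel35_of_normalForm ρ𝔤 hprim hh T2₀ T2₁ T4₀ T4₁ n m hn (h30 n m) hz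
  · -- (b40)
    by_cases hz : u n (m + 3 + 3) = 0
    · have hC' : C (n + 1) (m + 3) = 0 := by
        have := (hzero (n + 1) (m + 3)).2.2.1; rw [add_sub_cancel_right] at this; exact this hz
      have hA' : A (n - 1) (m + 3) = 0 := by
        have := (hzero (n - 1) (m + 3)).2.1; rw [sub_add_cancel] at this; exact this hz
      rw [hC', hA', mul_zero, mul_zero, mul_zero, mul_zero]
    · exact rel40_of_normalForm ρ𝔤 T1₀ T1₁ T2₀ n m hz
  · -- (b45)
    by_cases hz : u n (m - 3 - 3) = 0
    · have hD' : D (n + 1) (m - 3) = 0 := by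
        have := (hzero (n + 1) (m - 3)).2.2.2.2; rw [add_sub_cancel_right] at this; exact this hz
      have hB' : B (n - 1) (m - 3) = 0 := by
        have := (hzero (n - 1) (m - 3)).2.2.2.1; rw [sub_add_cancel] at this; exact this hz
      rw [hD', hB', mul_zero, mul_zero, mul_zero, mul_zero]
    · exact rel45_of_normalForm ρ𝔤 T3₀ T3₁ T4₀ n m hz

end Summit.HodgeConjecture.HodgeConjecture.Cruxes.H413.K2E1bU21DatumRelations

end
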